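/-
Copyright (c) 2026 the pub-hodgecm-mathlib formalisation cell (harness21).  Prover seat hodgecm-mathlib-K2E3-p04 (g0), Track B ∕ K2-LIT
(build stream 29), h413 = `stmt-HodgeConjecture-24833`, line `K2_E3_EllipticInputs`, unit U4 «Keys» — DEAL `K2E3RankOneIntertwiningIntegral`, road I, brick I-3a
«THE EXACT CELL FUNCTION OF THE SPHERICAL VECTOR».  2026-09-03.
-/
import Summits.HodgeConjecture.HodgeConjecture.Theorems.F0P3cStCharTSKeys3AnnulusDock          -- ★ brings B4∕FILE 1 (`toFun_weylElt_mul_eq_of_isUnit`, `exists_unipotentU_entries_eq`, `valued_entry_zero_one_sq_le`, `neg_one_mem_normOneUnits`) and ★ DICT (`prod_normAbs_*`, `isUnit_iff_ne_zero_localRing`)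
import Summits.HodgeConjecture.HodgeConjecture.Theorems.F0P3cStCharTSK0WeylG                    -- ★ `localNonsplitEquiv_weylElt_mem_glInt_three` (the long Weyl element is integral in the one-place model)
import Literature.NumberTheory.Automorphic.HeisenbergChartShearedAtNonsplitPlace                  -- ★ `heisElt_mem_cmLocalIntegralLevel_iff_heisZ` (`u(x,z) ∈ K_v ↔ |x_w| ≤ 1 ∧ |z_w| ≤ 1`); brings ★ `HeisRing.heisElt_heisX_heisY`
import Literature.NumberTheory.Automorphic.CMPrincipalSeriesSpherical                              -- ★ `Representation.mem_fixedPoints_smoothIndRep_iff` (via `SmoothInductionSphericalLine`)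
import Literature.NumberTheory.Automorphic.LocalUnitaryIntegralLevel                               -- ★ `mem_localIntegralLevel_iff_of_smul_eq` (`g ∈ U(Φ₃)(𝒪_v) ↔ g_w ∈ GL₃(𝒪_w)`)
import HarnessLib

/-!
# h413 ∕ Track B «K2-LIT», unit U4 «Keys», DEAL `K2E3RankOneIntertwiningIntegral`, road I brick I-3a: THE EXACT CELL FUNCTION OF A `K_v`-FIXED VECTOR of `i_G(χ₁, χ₂)` on
# `U(Φ₃)(L⁺_v)` (`v` non-split) — `f(w₀ u) = f(1)` if `‖u₀₂‖ ≤ 1`, and `f(w₀ u) = χ₁(σ b)⁻¹ χ₂(−1) ‖b‖⁻¹ · f(1)` if `b = u₀₂` has `‖b‖ > 1`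
# (the integrand of Harish-Chandra's `c_w(χ) = ∫_N f_K(w₀ n) dn`, ★ `K2E3IntertwiningIntegralSphericalLine`)  [Casselman1995 §6.4; Keys1984 §4; Rogawski1990 §4.5]

Cell `pub/hodgecm-mathlib`, crux H413 = `stmt-HodgeConjecture-24833` (lane `--supports … --as helper`), route HCCMUnconditional; dealer K2E3-plan (g1) («Road I files stay
`--supports 24833 --as helper`», 2026-09-03T23:02Z).  THEOREMS ONLY (0 def ∕ 0 instance ∕ 0 notation ∕ 0 sorry); ★-only imports.  With ★ I-2a
(`J(w, χ) f_K = c_w(χ) • f'_K`, `c_w(χ) = ∫_N f_K(w₀ n) dμ`) this reduces the closed form of `c_w(χ)` (road I-3 ∕ II-2, K2E3-p05) to SHELL ARITHMETIC on `N(L⁺_v)`: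
`c_w(χ) = μ{‖u₀₂‖ ≤ 1} + χ₂(−1) Σ_shells χ₁(σ b)⁻¹ ‖b‖⁻¹ μ(shell)`.

THE MATHEMATICS ([Casselman1995, §6.4; Prop. 1.3.3]; [Rogawski1990, §1.10 p. 9, §4.5 p. 45]).  `K_v = U(Φ₃)(𝒪_v)` (★ `cmLocalIntegralLevel`), `w₀` of matrix `Φ₃`, `u ∈ N` with entries
`a = u₀₁`, `b = u₀₂` (`|a|_w² ≤ |b|_w`, ★ `valued_entry_zero_one_sq_le`).
* §1 **`weylElt_mem_cmLocalIntegralLevel`** — `w₀ ∈ K_v` (`Φ₃ ∈ GL₃(𝒪_w)` in the one-place model ★ `localNonsplitEquiv_weylElt_mem_glInt_three` + ★ `mem_localIntegralLevel_iff_of_smul_eq`).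
* §2 **`unipotent_mem_cmLocalIntegralLevel_of_height_le_one`** — `‖b‖ ≤ 1 ⇒ u ∈ K_v` (then `|a|_w ≤ 1` too; in the Heisenberg chart `u = u(x, z)` with `x = a`, `z = b`, ★
  `heisElt_heisX_heisY` ∕ `heisZ_heisX_heisY`, and ★ `heisElt_mem_cmLocalIntegralLevel_iff_heisZ`).
* §3 **`toFun_weylElt_mul_eq_toFun_one_of_height_le_one`** — for a `K_v`-fixed `f`: `‖b‖ ≤ 1 ⇒ f(w₀ u) = f(1)` (`w₀ u ∈ K_v`).
* §4 **`toFun_weylElt_mul_eq_of_one_lt_height`** — for a `K_v`-fixed `f` and `‖b‖ > 1`: `f(w₀ u) = χ₁(σ b)⁻¹ · χ₂(−1) · ‖b‖⁻¹ · f(1)` — ★ FILE 1 `toFun_weylElt_mul_eq_of_isUnit`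
  (`f(w₀ u) = χ₁(σb)⁻¹ χ₂(−1) ‖b‖⁻¹ f(w₀ u′ w₀⁻¹)`, `u′` of entries `(ab⁻¹, b⁻¹)`) where now `u′ ∈ K_v` by §2 (`‖b⁻¹‖ < 1`), so `w₀ u′ w₀⁻¹ ∈ K_v` (§1) and `f(w₀ u′ w₀⁻¹) = f(1)`.
  No threshold `A₀`: for a SPHERICAL vector the far-out formula of ★ B4 holds on the nose outside the unit ball.

HONEST LABEL.  HC_CM is proved only modulo the 7 printed citations (2 remaining named inputs: hLiu418 = `stmt-HodgeConjecture-24832`, h413 = `stmt-HodgeConjecture-24833`) until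
rung 0 closes; count-neutral.  The shell volumes `μ{‖u₀₂‖ = q^k}` (by ramification type) and the resulting closed form of `c_w(χ)` are NOT here.

## References
* [Casselman1995] W. Casselman, *Introduction to the theory of admissible representations of `p`-adic reductive groups* (1995), Prop. 1.3.3, §6.4 pp. 62–64.
* [Keys1984] D. Keys, *Principal series representations of special unitary groups over local fields*, Compositio Math. 51 (1984), §4.
* [Rogawski1990] J. D. Rogawski, *Automorphic Representations of Unitary Groups in Three Variables* (1990), §1.10 p. 9, §4.5 p. 45.
* [PlatonovRapinchuk1994] V. Platonov, A. Rapinchuk, *Algebraic Groups and Number Theory* (1994), §5.1 (integral points of the one-place model).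
-/

set_option autoImplicit false
-- the mandated namespace repeats the single-problem summit's segment (`HodgeConjecture.HodgeConjecture`)
set_option linter.dupNamespace false

noncomputable section

open NumberField IsDedekindDomain MeasureTheory
open scoped Matrix NNReal ENNReal

open Literature.NumberTheory Literature.NumberTheory.Automorphic Literature.NumberTheory.Automorphic.UnitaryGroup
open Literature.NumberTheory.GaloisRepresentations Literature.NumberTheory.GaloisRepresentations.IsNonarchimedeanLocalField

namespace Summit.HodgeConjecture.HodgeConjecture.Cruxes.H413.K2E3SphericalCellFunction

variable (L : Type) [Field L] [NumberField L] [IsCMField L] (v : HeightOneSpectrum (𝓞 ↥(maximalRealSubfield L)))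
  (w : PlacesOver L v) (hw : IsCMField.complexConj L • w.1 = w.1)

/-! ## §1 The long Weyl element lies in `K_v` -/

include hw in
/-- **`w₀ ∈ K_v = U(Φ₃)(𝒪_v)`** at a non-split `v`: in the one-place model `w₀ ↦ Φ₃ ∈ GL₃(𝒪_w)` (★ `localNonsplitEquiv_weylElt_mem_glInt_three`), and `K_v` is the pull-back of
`GL₃(𝒪_w)` (★ `mem_localIntegralLevel_iff_of_smul_eq`). [cite: Rogawski1990, §1.10 p. 9] [cite: PlatonovRapinchuk1994, §5.1] -/
theorem weylElt_mem_cmLocalIntegralLevel (w₀ : ↥(unitaryGroupOfForm (conjLocal L (IsCMField.complexConj L) v) (cmLocalForm L 3 v))) (hw₀ : Units.val (w₀ : GL (Fin 3) (LocalRing L v)) = cmLocalForm L 3 v) :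
    w₀ ∈ cmLocalIntegralLevel L 3 (Matrix.of fun i j : Fin 3 => if i.val + j.val + 1 = 3 then (1 : L) else 0) v :=
  (mem_localIntegralLevel_iff_of_smul_eq (IsCMField.complexConj L) 3 (Rogawski1990.qsForm L) (IsCMField.complexConj_ne_one L) w hw w₀).2
    (F0P3cStCharTSK0WeylG.localNonsplitEquiv_weylElt_mem_glInt_three L v w hw w₀ hw₀)

/-! ## §2 An element of `N` whose `(0,2)` entry has height `≤ 1` lies in `K_v` -/

set_option synthInstance.maxHeartbeats 400000 in
set_option maxHeartbeats 3200000 in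
-- the Heisenberg chart identities `u = u(x(u), y(u))`, `z(u) = u₀₂` are rewritten inside the matrix-group carrier (class of ★ (β) `isCompact_normBall_of_chart`)
include hw in
/-- **`‖u₀₂‖ ≤ 1 ⇒ u ∈ K_v`** for `u ∈ N(L⁺_v)` (`v` non-split): `|u₀₁|_w² ≤ |u₀₂|_w ≤ 1` (★ `valued_entry_zero_one_sq_le`), so in the Heisenberg chart `u = u(x, z)` (★ `heisElt_heisX_heisY`,
`x = u₀₁`, `z = u₀₂` ★ `heisZ_heisX_heisY`) both coordinates are integral, which is `K_v`-membership (★ `heisElt_mem_cmLocalIntegralLevel_iff_heisZ`).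
[cite: Rogawski1990, §1.10 p. 9; §4.5 p. 45] [cite: PlatonovRapinchuk1994, §5.1] -/
theorem unipotent_mem_cmLocalIntegralLevel_of_height_le_one (u : ↥(cmBorelTriple L 3 v).N)
    (hu : (∏ w' : PlacesOver L v, normAbs (w'.1.adicCompletion L) ((((((u : ↥(unitaryGroupOfForm (conjLocal L (IsCMField.complexConj L) v) (cmLocalForm L 3 v)))) : GL (Fin 3) (LocalRing L v)) : Matrix (Fin 3) (Fin 3) (LocalRing L v)) 0 2) w')) ≤ 1) :
    (u : ↥(unitaryGroupOfForm (conjLocal L (IsCMField.complexConj L) v) (cmLocalForm L 3 v))) ∈ cmLocalIntegralLevel L 3 (Matrix.of fun i j : Fin 3 => if i.val + j.val + 1 = 3 then (1 : L) else 0) v := by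
  letI : Invertible (2 : LocalRing L v) := (isUnit_two_localRing L v).invertible
  have hb : Valued.v ((((((u : ↥(unitaryGroupOfForm (conjLocal L (IsCMField.complexConj L) v) (cmLocalForm L 3 v)))) : GL (Fin 3) (LocalRing L v)) : Matrix (Fin 3) (Fin 3) (LocalRing L v)) 0 2) w) ≤ 1 := by
    rw [F0P3cStCharTSLocalRingNormDictionary.prod_normAbs_eq_normAbs_apply L v w hw] at hu
    have h := (normAbs_le_normAbs_iff_valued w.1 ((((((u : ↥(unitaryGroupOfForm (conjLocal L (IsCMField.complexConj L) v) (cmLocalForm L 3 v)))) : GL (Fin 3) (LocalRing L v)) : Matrix (Fin 3) (Fin 3) (LocalRing L v)) 0 2) w) 1).1 (by rwa [map_one])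
    rwa [map_one] at h
  have ha : Valued.v ((((((u : ↥(unitaryGroupOfForm (conjLocal L (IsCMField.complexConj L) v) (cmLocalForm L 3 v)))) : GL (Fin 3) (LocalRing L v)) : Matrix (Fin 3) (Fin 3) (LocalRing L v)) 0 1) w) ≤ 1 := by
    by_contra h
    rw [not_le] at h
    have hsq := F0P3cStCharTSCellFunFarOut.valued_entry_zero_one_sq_le L v w hw u
    exact absurd (hsq.trans hb) (not_le.2 (one_lt_mul'' h h))
  have hux : HeisRing.heisX (conjLocal L (IsCMField.complexConj L) v) u = (((((u : ↥(unitaryGroupOfForm (conjLocal L (IsCMField.complexConj L) v) (cmLocalForm L 3 v)))) : GL (Fin 3) (LocalRing L v)) : Matrix (Fin 3) (Fin 3) (LocalRing L v)) 0 1) := rfl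
  rw [← HeisRing.heisElt_heisX_heisY (conjLocal L (IsCMField.complexConj L) v) (conjLocal_conjLocal_cm L v) (cmLocalForm_eq_over L 3 v) u]
  refine (heisElt_mem_cmLocalIntegralLevel_iff_heisZ L v w hw _ _).2 ⟨?_, ?_⟩
  · rw [hux]; exact ha
  · rw [F0P3cStCharTSHeisenbergAnnulusSlice.heisZ_heisX_heisY (conjLocal L (IsCMField.complexConj L) v) (conjLocal_conjLocal_cm L v) (cmLocalForm_eq_over L 3 v) u]; exact hb

/-! ## §3 On the unit ball the cell function of a `K_v`-fixed vector is constant `= f(1)` -/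

set_option synthInstance.maxHeartbeats 400000 in
set_option maxHeartbeats 4000000 in
-- statement over the `SmoothInd` carrier of ★ `cmPrincipalSeries` (class of ★ B4)
include hw in
/-- **`f(w₀ u) = f(1)` for `‖u₀₂‖ ≤ 1`**, `f` a `K_v`-fixed vector of the carrier of ★ `cmPrincipalSeries L 3 v χ` (`v` non-split, `w₀` of matrix `Φ₃`): `w₀ u ∈ K_v` (§1, §2) and a `K_v`-fixed `f`
satisfies `f(x k) = f(x)` (★ `mem_fixedPoints_smoothIndRep_iff`). [cite: Casselman1995, §6.4 p. 63] [cite: Rogawski1990, §4.5 p. 45] -/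
theorem toFun_weylElt_mul_eq_toFun_one_of_height_le_one (χ : ↥(torusU (conjLocal L (IsCMField.complexConj L) v) (cmLocalForm L 3 v)) →* ℂˣ)
    (w₀ : ↥(unitaryGroupOfForm (conjLocal L (IsCMField.complexConj L) v) (cmLocalForm L 3 v))) (hw₀ : Units.val (w₀ : GL (Fin 3) (LocalRing L v)) = cmLocalForm L 3 v)
    (f : haveI := locallyCompactSpace_cmBorelU L 3 v
      Representation.SmoothInd (cmBorelTriple L 3 v).P
        (Representation.twist
          (((Representation.trivial ℂ ↥(torusU (conjLocal L (IsCMField.complexConj L) v) (cmLocalForm L 3 v)) ℂ).twist χ).comp (cmBorelTriple L 3 v).proj)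
          (rootDeltaChar (cmBorelTriple L 3 v).P)))
    (hf : haveI := locallyCompactSpace_cmBorelU L 3 v
      f ∈ (Representation.smoothIndRep (cmBorelTriple L 3 v).P _).fixedPoints (cmLocalIntegralLevel L 3 (Matrix.of fun i j : Fin 3 => if i.val + j.val + 1 = 3 then (1 : L) else 0) v))
    (u : ↥(cmBorelTriple L 3 v).N) (hu : (∏ w' : PlacesOver L v, normAbs (w'.1.adicCompletion L) ((((((u : ↥(unitaryGroupOfForm (conjLocal L (IsCMField.complexConj L) v) (cmLocalForm L 3 v)))) : GL (Fin 3) (LocalRing L v)) : Matrix (Fin 3) (Fin 3) (LocalRing L v)) 0 2) w')) ≤ 1) :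
    f.toFun (w₀ * (u : ↥(unitaryGroupOfForm (conjLocal L (IsCMField.complexConj L) v) (cmLocalForm L 3 v)))) = f.toFun 1 := by
  haveI := locallyCompactSpace_cmBorelU L 3 v
  have hk : w₀ * (u : ↥(unitaryGroupOfForm (conjLocal L (IsCMField.complexConj L) v) (cmLocalForm L 3 v))) ∈ cmLocalIntegralLevel L 3 (Matrix.of fun i j : Fin 3 => if i.val + j.val + 1 = 3 then (1 : L) else 0) v :=
    Subgroup.mul_mem _ (weylElt_mem_cmLocalIntegralLevel L v w hw w₀ hw₀) (unipotent_mem_cmLocalIntegralLevel_of_height_le_one L v w hw u hu)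
  have h := (Representation.mem_fixedPoints_smoothIndRep_iff (cmBorelTriple L 3 v).P (cmLocalIntegralLevel L 3 (Matrix.of fun i j : Fin 3 => if i.val + j.val + 1 = 3 then (1 : L) else 0) v) _ f).1 hf _ hk 1
  rwa [one_mul] at h

/-! ## §4 Outside the unit ball: `f(w₀ u) = χ₁(σ b)⁻¹ · χ₂(−1) · ‖b‖⁻¹ · f(1)` on the nose -/

set_option synthInstance.maxHeartbeats 400000 in
set_option maxHeartbeats 6000000 in
-- statement∕proof over the `SmoothInd` carrier of ★ `cmPrincipalSeries` (class of ★ FILE 1 `toFun_weylElt_mul_eq_of_isUnit`)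
include hw in
/-- **THE EXACT FAR-OUT CELL FUNCTION OF A `K_v`-FIXED VECTOR.**  `v` non-split, `w₀` of matrix `Φ₃`, `f` a `K_v`-fixed vector of the carrier of ★ `cmPrincipalSeries L 3 v (χ₁, χ₂)`, `u ∈ N` with
`b = u₀₂` of height `‖b‖ > 1`.  Then `b` is a unit and **`f(w₀ u) = χ₁(σ b)⁻¹ · χ₂(−1) · ‖b‖⁻¹ · f(1)`**: ★ FILE 1 `toFun_weylElt_mul_eq_of_isUnit` gives this with `f(w₀ u′ w₀⁻¹)` in place
of `f(1)`, `u′ ∈ N` of entries `(a b⁻¹, b⁻¹)` (★ `exists_unipotentU_entries_eq`); `‖u′₀₂‖ = ‖b‖⁻¹ < 1` puts `u′ ∈ K_v` (§2), so `w₀ u′ w₀⁻¹ ∈ K_v` (§1) and `f(w₀ u′ w₀⁻¹) = f(1)`.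
[cite: Casselman1995, §6.4 p. 63; Prop. 1.3.3] [cite: Keys1984, §4] [cite: Rogawski1990, §4.5 p. 45, §12.1 p. 171] -/
theorem toFun_weylElt_mul_eq_of_one_lt_height
    (χ₁ : (LocalRing L v)ˣ →* ℂˣ) (χ₂ : ↥(normOneUnits (conjLocal L (IsCMField.complexConj L) v)) →* ℂˣ)
    (w₀ : ↥(unitaryGroupOfForm (conjLocal L (IsCMField.complexConj L) v) (cmLocalForm L 3 v))) (hw₀ : Units.val (w₀ : GL (Fin 3) (LocalRing L v)) = cmLocalForm L 3 v)
    (f : haveI := locallyCompactSpace_cmBorelU L 3 v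
      Representation.SmoothInd (cmBorelTriple L 3 v).P
        (Representation.twist
          (((Representation.trivial ℂ ↥(torusU (conjLocal L (IsCMField.complexConj L) v) (cmLocalForm L 3 v)) ℂ).twist
            (cmTorusCharPair L v χ₁ χ₂)).comp (cmBorelTriple L 3 v).proj) (rootDeltaChar (cmBorelTriple L 3 v).P)))
    (hf : haveI := locallyCompactSpace_cmBorelU L 3 v
      f ∈ (Representation.smoothIndRep (cmBorelTriple L 3 v).P _).fixedPoints (cmLocalIntegralLevel L 3 (Matrix.of fun i j : Fin 3 => if i.val + j.val + 1 = 3 then (1 : L) else 0) v))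
    (u : ↥(cmBorelTriple L 3 v).N) (hu : 1 < (∏ w' : PlacesOver L v, normAbs (w'.1.adicCompletion L) ((((((u : ↥(unitaryGroupOfForm (conjLocal L (IsCMField.complexConj L) v) (cmLocalForm L 3 v)))) : GL (Fin 3) (LocalRing L v)) : Matrix (Fin 3) (Fin 3) (LocalRing L v)) 0 2) w')))
    (hb : IsUnit (((((u : ↥(unitaryGroupOfForm (conjLocal L (IsCMField.complexConj L) v) (cmLocalForm L 3 v)))) : GL (Fin 3) (LocalRing L v)) : Matrix (Fin 3) (Fin 3) (LocalRing L v)) 0 2)) :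
    f.toFun (w₀ * (u : ↥(unitaryGroupOfForm (conjLocal L (IsCMField.complexConj L) v) (cmLocalForm L 3 v)))) =
      ((((χ₁ (Units.map (conjLocal L (IsCMField.complexConj L) v : LocalRing L v →* LocalRing L v) hb.unit))⁻¹ : ℂˣ) : ℂ) *
          ((χ₂ ⟨-1, F0P3cStCharTSBigCellFactorisation.neg_one_mem_normOneUnits (conjLocal L (IsCMField.complexConj L) v)⟩ : ℂˣ) : ℂ) *
          ((((unitModulusChar (LocalRing L v) hb.unit)⁻¹ : ℝ≥0) : ℝ) : ℂ)) • f.toFun 1 := by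
  haveI := locallyCompactSpace_cmBorelU L 3 v
  letI : Invertible (2 : LocalRing L v) := (isUnit_two_localRing L v).invertible
  obtain ⟨u', h1, h2⟩ := F0P3cStCharTSBigCellFactorisation.exists_unipotentU_entries_eq (conjLocal L (IsCMField.complexConj L) v)
    (conjLocal_conjLocal_cm L v) (cmLocalForm_eq_over L 3 v) u hb.unit hb.unit_spec.symm
  -- `u′ ∈ K_v`: its `(0,2)` entry `b⁻¹` has height `‖b‖⁻¹ ≤ 1`
  have hnorm : ((unitModulusChar (LocalRing L v) hb.unit : ℝ≥0)) = (∏ w' : PlacesOver L v, normAbs (w'.1.adicCompletion L) ((((((u : ↥(unitaryGroupOfForm (conjLocal L (IsCMField.complexConj L) v) (cmLocalForm L 3 v)))) : GL (Fin 3) (LocalRing L v)) : Matrix (Fin 3) (Fin 3) (LocalRing L v)) 0 2) w')) := by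
    rw [unitModulusChar_localRing_eq_prod, hb.unit_spec]
  have hu' : (∏ w' : PlacesOver L v, normAbs (w'.1.adicCompletion L) ((((((u' : ↥(unitaryGroupOfForm (conjLocal L (IsCMField.complexConj L) v) (cmLocalForm L 3 v)))) : GL (Fin 3) (LocalRing L v)) : Matrix (Fin 3) (Fin 3) (LocalRing L v)) 0 2) w')) ≤ 1 := by
    rw [h2, ← unitModulusChar_localRing_eq_prod, map_inv, hnorm]
    exact inv_le_one_of_one_le₀ hu.le
  have hL : w₀ * (u' : ↥(unitaryGroupOfForm (conjLocal L (IsCMField.complexConj L) v) (cmLocalForm L 3 v))) * w₀⁻¹ ∈ cmLocalIntegralLevel L 3 (Matrix.of fun i j : Fin 3 => if i.val + j.val + 1 = 3 then (1 : L) else 0) v :=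
    Subgroup.mul_mem _ (Subgroup.mul_mem _ (weylElt_mem_cmLocalIntegralLevel L v w hw w₀ hw₀)
      (unipotent_mem_cmLocalIntegralLevel_of_height_le_one L v w hw u' hu')) (Subgroup.inv_mem _ (weylElt_mem_cmLocalIntegralLevel L v w hw w₀ hw₀))
  have hfL : f.toFun (w₀ * (u' : ↥(unitaryGroupOfForm (conjLocal L (IsCMField.complexConj L) v) (cmLocalForm L 3 v))) * w₀⁻¹) = f.toFun 1 := by
    have h := (Representation.mem_fixedPoints_smoothIndRep_iff (cmBorelTriple L 3 v).P (cmLocalIntegralLevel L 3 (Matrix.of fun i j : Fin 3 => if i.val + j.val + 1 = 3 then (1 : L) else 0) v) _ f).1 hf _ hL 1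
    rwa [one_mul] at h
  rw [F0P3cStCharTSBigCellFactorisation.toFun_weylElt_mul_eq_of_isUnit L v χ₁ χ₂ w₀ hw₀ f u u' hb.unit hb.unit_spec.symm h1 h2, hfL, smul_eq_mul]

end Summit.HodgeConjecture.HodgeConjecture.Cruxes.H413.K2E3SphericalCellFunction

end
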